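import Literature.NumberTheory.Transcendental.SEACNonSplitting
import Literature.ModelTheory.Quasiminimal.Isolation
import Literature.ModelTheory.Quasiminimal.CountableModels
import HarnessLib

/-!
# Isolation of types in closures and homogeneity over closed sets (Bays–Kirby 2018, Thm 6.9,
QM5) for countable strongly exponentially-algebraically closed fields

M. Bays, B. Hart, T. Hyttinen, M. Kesälä, J. Kirby, *Quasiminimal structures and excellence*,
Bull. LMS 46 (2014), Prop. 5.2 and Cor. 5.3: from non-splitting over a finite set (Bays–Kirby 2018,
Thm 6.9, QM5b; `SEACModel.exists_notSplit`) and `ℵ₀`-homogeneity over `∅` with uniqueness of the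
generic type (here: Galois types, `SEACModel.baseAut`), the types of tuples inside the closure of a
closed countable set and a finite tuple are s-isolated (Prop. 5.2), and consequently the structure
is `ℵ₀`-homogeneous over closed countable sets (Cor. 5.3, (c) ⟹ (a)) — axiom QM5 of Def. 6.1 of
Bays–Kirby 2018. All statements are in terms of the group `Aut(M / ecl S)` and the localised
closure `C ↦ ecl (S ∪ C)`:

* `SEACModel.exists_mem_baseAut_comp_eq_of_indepFamilyOver` — independent tuples over a finite set
  are conjugate over it (iterated uniqueness of the generic type);
* `SEACModel.exists_isolation` — BHHKK Prop. 5.2 (orbit form);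
* `SEACModel.homogeneity_over_closed` — BHHKK Cor. 5.3 / Bays–Kirby Def. 6.1 QM5 over closed sets
  (orbit form).

## References

* M. Bays, B. Hart, T. Hyttinen, M. Kesälä, J. Kirby, *Quasiminimal structures and excellence*,
  Bull. LMS 46 (2014) 155–163: Def. 5.1, Prop. 5.2, Cor. 5.3.
* M. Bays, J. Kirby, *Pseudo-exponential maps, variants, and quasiminimality*, Algebra & Number
  Theory 12 (2018): Def. 6.1 (QM5), Prop. 6.5, Thm 6.9.
-/

noncomputable section

open Set

universe u

namespace Literature.NumberTheory.Transcendental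

namespace SEACModel

open Literature.ModelTheory.ExponentialFields.ExponentialRing Literature.ModelTheory.Quasiminimal
  ZilberHomogeneity

variable {M : Type u} [Field M] [CharZero M] [Literature.ModelTheory.ExponentialFields.ExponentialRing M]

/-! ### Transport of independence along automorphisms -/

omit [CharZero M] in
/-- Automorphisms over `ecl S` transport independent families (over a set) to independent families
(over the image set), for the localised closure. [folklore] -/
theorem indepFamilyOver_comp_of_mem_baseAut {S : Set M} {σ : Equiv.Perm M} (hσ : σ ∈ baseAut S)
    {G : Set M} {ι : Type*} {b : ι → M} (hb : IndepFamilyOver (fun C => ecl (S ∪ C)) G b) :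
    IndepFamilyOver (fun C => ecl (S ∪ C)) (⇑σ '' G) (⇑σ ∘ b) := by
  intro i hi
  refine hb i ((apply_mem_ecl_union_iff hσ _ (b i)).1 ?_)
  have : ⇑σ '' (G ∪ b '' {j | j ≠ i}) = ⇑σ '' G ∪ (⇑σ ∘ b) '' {j | j ≠ i} := by
    rw [image_union, image_comp]
  rw [this]
  exact hi

omit [CharZero M] in
/-- Shrinking the base along closures keeps independence: if `G' ⊆ cl G` then a family independent
over `cl G` is independent over `G'`. [folklore] -/
theorem indepFamilyOver_of_subset_cl {S G G' : Set M} {ι : Type*} {b : ι → M}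
    (hb : IndepFamilyOver (fun C => ecl (S ∪ C)) (ecl (S ∪ G)) b) (hG' : G' ⊆ ecl (S ∪ G)) :
    IndepFamilyOver (fun C => ecl (S ∪ C)) G' b := fun i hi =>
  hb i (ecl_mono (union_subset_union_right S (union_subset_union_left _ hG')) hi)

omit [CharZero M] in
/-- Reindexing an independent family along an injective map. [folklore] -/
theorem indepFamilyOver_comp_injective {S G : Set M} {ι κ : Type*} {b : ι → M}
    (hb : IndepFamilyOver (fun C => ecl (S ∪ C)) G b) {f : κ → ι} (hf : Function.Injective f) :
    IndepFamilyOver (fun C => ecl (S ∪ C)) G (b ∘ f) := by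
  intro k hk
  refine hb (f k) (ecl_mono (union_subset_union_right S (union_subset_union_right G ?_)) hk)
  rintro _ ⟨k', hk', rfl⟩
  exact ⟨f k', fun h => hk' (hf h), rfl⟩

omit [CharZero M] in
/-- An injective enumeration of an independent set is an independent family. [folklore] -/
theorem indepFamilyOver_of_embedding {S G J : Set M}
    (hJ : IndepFamilyOver (fun C => ecl (S ∪ C)) G ((↑) : J → M)) {k : ℕ} (f : Fin k ↪ M)
    (hf : range f = J) : IndepFamilyOver (fun C => ecl (S ∪ C)) G f := by
  intro i hi
  have hmem : f i ∈ J := hf ▸ ⟨i, rfl⟩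
  refine hJ ⟨f i, hmem⟩ (ecl_mono (union_subset_union_right S (union_subset_union_right G ?_)) hi)
  rintro _ ⟨j, hj, rfl⟩
  refine ⟨⟨f j, hf ▸ ⟨j, rfl⟩⟩, fun h => hj ?_, rfl⟩
  exact f.injective (congrArg Subtype.val h)

omit [Field M] [CharZero M] [Literature.ModelTheory.ExponentialFields.ExponentialRing M] in
/-- A permutation fixing a set pointwise fixes it setwise.  DUPLICATE (dedup-00649) of Mathlib's
`Set.EqOn.image_eq_self` (`h : Set.EqOn f id s` is definitionally `∀ x ∈ s, f x = x`); kept only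
as a deprecated name — write `Set.EqOn.image_eq_self h`. [folklore] -/
@[deprecated Set.EqOn.image_eq_self (since := "2026-08-15")]
theorem image_eq_self_of_forall_apply_eq {σ : Equiv.Perm M} {C : Set M} (h : ∀ x ∈ C, σ x = x) :
    ⇑σ '' C = C :=
  Set.EqOn.image_eq_self h

omit [Field M] [CharZero M] [Literature.ModelTheory.ExponentialFields.ExponentialRing M] in
/-- The inverse of a permutation fixes the fixed points. [folklore] -/
theorem inv_apply_eq_self_of_apply_eq {σ : Equiv.Perm M} {x : M} (h : σ x = x) : σ⁻¹ x = x := by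
  rw [Equiv.Perm.inv_eq_iff_eq]; exact h.symm

/-! ### Independent tuples over a finite set are conjugate -/

section Countable

variable [IsAlgClosed M] [Countable M]

/-- **Independent tuples over a finite tuple are conjugate over it** (uniqueness of the generic
type of a tuple: iterated one-point uniqueness, Bays–Kirby 2018, Thm 6.9, QM4): if `u`, `v` are
families independent over `range y` for the localised closure, some automorphism over `ecl S`
fixes `y` and maps `u ↦ v`. [cite: BaysKirby2018ANT, Thm 6.9 (QM4)] [cite: BHHKK2014, Prop. 5.2 (proof)] -/
theorem exists_mem_baseAut_comp_eq_of_indepFamilyOver (hsurj : IsSurjectiveOntoUnits M)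
    (hSEAC : IsStronglyExpAlgClosed M) (hinf : ∀ C : Set M, C.Finite → ∃ d, d ∉ ecl C)
    {S : Set M} (hS : S.Finite) {p : ℕ} (y : Fin p → M) :
    ∀ {k : ℕ} (u v : Fin k → M),
      IndepFamilyOver (fun C => ecl (S ∪ C)) (range y) u →
      IndepFamilyOver (fun C => ecl (S ∪ C)) (range y) v →
        ∃ τ ∈ baseAut S, (∀ i, τ (y i) = y i) ∧ ⇑τ ∘ u = v := by
  intro k
  induction k with
  | zero =>
    intro u v _ _
    exact ⟨1, (baseAut S).one_mem, fun _ => rfl, funext fun i => i.elim0⟩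
  | succ k ih =>
    intro u v hu hv
    -- match the initial segments
    obtain ⟨τ₀, hτ₀, hτ₀y, hτ₀u⟩ := ih (u ∘ Fin.castSucc) (v ∘ Fin.castSucc)
      (indepFamilyOver_comp_injective hu (Fin.castSucc_injective k))
      (indepFamilyOver_comp_injective hv (Fin.castSucc_injective k))
    -- the last points are generic over `y` and the initial segment of `v`
    have hsub : ∀ (w : Fin (k + 1) → M), range y ∪ range (w ∘ Fin.castSucc) ⊆
        range y ∪ w '' {j | j ≠ Fin.last k} := by
      intro w
      refine union_subset_union_right _ ?_
      rintro _ ⟨i, rfl⟩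
      exact ⟨Fin.castSucc i, (Fin.castSucc_lt_last i).ne, rfl⟩
    have hvlast : v (Fin.last k) ∉ ecl (S ∪ (range y ∪ range (v ∘ Fin.castSucc))) :=
      fun h => hv (Fin.last k) (ecl_mono (union_subset_union_right S (hsub v)) h)
    have hulast : u (Fin.last k) ∉ ecl (S ∪ (range y ∪ range (u ∘ Fin.castSucc))) :=
      fun h => hu (Fin.last k) (ecl_mono (union_subset_union_right S (hsub u)) h)
    have hxy : ⇑τ₀ ∘ Fin.append y (u ∘ Fin.castSucc) = Fin.append y (v ∘ Fin.castSucc) := by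
      funext i
      refine Fin.addCases (fun j => ?_) (fun j => ?_) i
      · simp only [Function.comp_apply, Fin.append_left]; exact hτ₀y j
      · simp only [Function.comp_apply, Fin.append_right]; exact congrFun hτ₀u j
    have ha : τ₀ (u (Fin.last k)) ∉ ecl (S ∪ range (Fin.append y (v ∘ Fin.castSucc))) := by
      rw [apply_mem_ecl_union_range_iff hτ₀ hxy, range_append_eq_union]
      exact hulast
    have ha' : v (Fin.last k) ∉ ecl (S ∪ range (Fin.append y (v ∘ Fin.castSucc))) := by
      rw [range_append_eq_union]; exact hvlast
    obtain ⟨σ, hσ, hσfix, hσa⟩ :=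
      exists_mem_baseAut_apply_eq_of_notMem hsurj hSEAC hinf hS (Fin.append y (v ∘ Fin.castSucc)) ha ha'
    refine ⟨σ * τ₀, (baseAut S).mul_mem hσ hτ₀, fun i => ?_, ?_⟩
    · rw [Equiv.Perm.mul_apply, hτ₀y i]
      have := hσfix (Fin.castAdd k i)
      simpa only [Fin.append_left] using this
    · funext i
      refine Fin.lastCases ?_ (fun j => ?_) i
      · rw [Function.comp_apply, Equiv.Perm.mul_apply]; exact hσa
      · rw [Function.comp_apply, Equiv.Perm.mul_apply]
        have h1 : τ₀ (u (Fin.castSucc j)) = v (Fin.castSucc j) := congrFun hτ₀u j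
        rw [h1]
        have := hσfix (Fin.natAdd p j)
        simpa only [Fin.append_right, Function.comp_apply] using this

/-! ### BHHKK Prop. 5.2: isolation of types inside the closure -/

set_option maxHeartbeats 800000 in
/-- **Isolation of types in the closure of a closed set and a finite tuple** (Bays–Hart–Hyttinen–
Kesälä–Kirby 2014, Prop. 5.2, orbit form; used for Bays–Kirby 2018, Thm 6.9, QM5): let `H` be
closed and countable for `C ↦ ecl (S ∪ C)`, `ā` a finite tuple and `b̄` a tuple from
`ecl (S ∪ H ∪ ā)`. Then there is a finite tuple `c` from `H` such that every `b̄'` conjugate to `b̄`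
over `c ∪ ā` is conjugate to `b̄` over `d ∪ c ∪ ā` for every finite tuple `d` from `H` —
`tp(b̄/H ā)` is s-isolated over `c ā`. Proof (loc. cit.): non-splitting of `tp(ā b̄/H)` over a
finite `c ⊆ H` (`exists_notSplit`), enlarged so that `ā` is independent from `H` over `c` and
`b̄ ∈ cl(c ā)`; then Claim 1 of the printed proof by uniqueness of generic types of independent
tuples (`exists_mem_baseAut_comp_eq_of_indepFamilyOver`) and freeness
(`IsPregeometry.mem_cl_of_mem_cl_union_of_indepFamilyOver`).
[cite: BHHKK2014, Prop. 5.2] [cite: BaysKirby2018ANT, Thm 6.9 (QM5)] -/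
theorem exists_isolation (hsurj : IsSurjectiveOntoUnits M) (hSEAC : IsStronglyExpAlgClosed M)
    (hinf : ∀ C : Set M, C.Finite → ∃ d, d ∉ ecl C)
    {S : Set M} (hS : S.Finite) {H : Set M} (hH : ecl (S ∪ H) = H)
    {n l : ℕ} (ab : Fin n → M) {bb : Fin l → M} (hbb : ∀ j, bb j ∈ ecl (S ∪ (H ∪ range ab))) :
    ∃ (r : ℕ) (c : Fin r → M), (∀ i, c i ∈ H) ∧
      ∀ bb' : Fin l → M,
        (∃ π ∈ baseAut S, (∀ i, π (c i) = c i) ∧ (∀ i, π (ab i) = ab i) ∧ ⇑π ∘ bb = bb') →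
        ∀ ⦃p : ℕ⦄ (d : Fin p → M), (∀ i, d i ∈ H) →
          ∃ π' ∈ baseAut S, (∀ i, π' (d i) = d i) ∧ (∀ i, π' (c i) = c i) ∧
            (∀ i, π' (ab i) = ab i) ∧ ⇑π' ∘ bb = bb' := by
  classical
  have hP : IsPregeometry (fun C : Set M => ecl (S ∪ C)) := isPregeometry_ecl_union S
  have hSH : S ⊆ H := fun z hz => hH ▸ subset_ecl _ (Or.inl hz)
  have hclH : ∀ {C : Set M}, C ⊆ H → ecl (S ∪ C) ⊆ H := fun hC => ecl_union_subset_of_closed hH hC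
  -- (1) non-splitting of `tp(ā b̄ / H)` over `a₀`
  obtain ⟨r₀, a₀, ha₀H, -, hNS⟩ := exists_notSplit hsurj hSEAC hinf hS hH (Fin.append ab bb)
  -- (2) the part `I` of `ā` independent over `H`, and a finite support `A₂ ⊆ H` of `ā` over `I`
  obtain ⟨I, hIab, hI, habI⟩ := hP.exists_indep_basis_over H (range ab)
  have hchar : ∀ i, ∃ T : Set M, T ⊆ H ∧ T.Finite ∧ ab i ∈ ecl (S ∪ (T ∪ I)) := by
    intro i
    obtain ⟨T, hT, hTfin, hiT⟩ := hP.finite_character (habI ⟨i, rfl⟩)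
    refine ⟨T ∩ H, inter_subset_right, hTfin.inter_of_left H, ecl_mono ?_ hiT⟩
    refine union_subset_union_right S fun t ht => ?_
    rcases hT ht with h | h
    · exact Or.inl ⟨ht, h⟩
    · exact Or.inr h
  choose T hTH hTfin habT using hchar
  -- (3) a finite support `A₃ ⊆ H` of `b̄` over `ā`
  have hchar' : ∀ j, ∃ T' : Set M, T' ⊆ H ∧ T'.Finite ∧ bb j ∈ ecl (S ∪ (T' ∪ range ab)) := by
    intro j
    obtain ⟨T', hT', hT'fin, hjT'⟩ := hP.finite_character (hbb j)
    refine ⟨T' ∩ H, inter_subset_right, hT'fin.inter_of_left H, ecl_mono ?_ hjT'⟩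
    refine union_subset_union_right S fun t ht => ?_
    rcases hT' ht with h | h
    · exact Or.inl ⟨ht, h⟩
    · exact Or.inr h
  choose T' hT'H hT'fin hbbT' using hchar'
  -- (4) the finite set `A = a₀ ∪ ⋃ Tᵢ ∪ ⋃ T'ⱼ ⊆ H`, enumerated by `c`
  set A : Set M := range a₀ ∪ (⋃ i, T i) ∪ ⋃ j, T' j with hAdef
  have hAfin : A.Finite :=
    ((finite_range a₀).union (finite_iUnion hTfin)).union (finite_iUnion hT'fin)
  have hAH : A ⊆ H := by
    rintro z ((⟨i, rfl⟩ | hz) | hz)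
    · exact ha₀H i
    · obtain ⟨i, hi⟩ := mem_iUnion.1 hz; exact hTH i hi
    · obtain ⟨j, hj⟩ := mem_iUnion.1 hz; exact hT'H j hj
  obtain ⟨r, c, hc⟩ := exists_tuple_range_eq hAfin
  have hcH : ∀ i, c i ∈ H := fun i => hAH (hc ▸ ⟨i, rfl⟩)
  have ha₀c : range a₀ ⊆ range c := by rw [hc, hAdef]; exact subset_union_left.trans subset_union_left
  have habc : ∀ i, ab i ∈ ecl (S ∪ (range c ∪ I)) := by
    intro i
    refine ecl_mono (union_subset_union_right S (union_subset_union_left I ?_)) (habT i)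
    rw [hc, hAdef]
    exact (subset_iUnion T i).trans (subset_union_right.trans subset_union_left)
  have hbbc : ∀ j, bb j ∈ ecl (S ∪ (range c ∪ range ab)) := by
    intro j
    refine ecl_mono (union_subset_union_right S (union_subset_union_left _ ?_)) (hbbT' j)
    rw [hc, hAdef]
    exact (subset_iUnion T' j).trans subset_union_right
  -- non-splitting over `c`
  have hNS' : ∀ ⦃p : ℕ⦄ (d d' : Fin p → M), (∀ i, d i ∈ H) → (∀ i, d' i ∈ H) →
      ∀ θ ∈ baseAut S, (∀ i, θ (c i) = c i) → ⇑θ ∘ d = d' →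
        ∃ θ' ∈ baseAut S, (∀ i, θ' (c i) = c i) ∧ ⇑θ' ∘ d = d' ∧
          (∀ i, θ' (ab i) = ab i) ∧ ∀ j, θ' (bb j) = bb j := by
    intro p d d' hd hd' θ hθ hθc hθd
    have ha₀fix : ∀ i, θ (a₀ i) = a₀ i := fun i => by
      obtain ⟨i', hi'⟩ := ha₀c ⟨i, rfl⟩; rw [← hi']; exact hθc i'
    obtain ⟨θ', hθ', -, hθ'cd, hθ'e⟩ := hNS (Fin.append c d) (Fin.append c d')
      (fun i => Fin.addCases (fun j => by simpa using hcH j) (fun j => by simpa using hd j) i)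
      (fun i => Fin.addCases (fun j => by simpa using hcH j) (fun j => by simpa using hd' j) i)
      θ hθ ha₀fix (by
        funext i
        refine Fin.addCases (fun j => ?_) (fun j => ?_) i
        · simp only [Function.comp_apply, Fin.append_left]; exact hθc j
        · simp only [Function.comp_apply, Fin.append_right]; exact congrFun hθd j)
    refine ⟨θ', hθ', fun i => ?_, ?_, fun i => ?_, fun j => ?_⟩
    · have := congrFun hθ'cd (Fin.castAdd p i)
      simpa only [Function.comp_apply, Fin.append_left] using this
    · funext i
      have := congrFun hθ'cd (Fin.natAdd r i)
      simpa only [Function.comp_apply, Fin.append_right] using this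
    · have := hθ'e (Fin.castAdd l i)
      simpa only [Fin.append_left] using this
    · have := hθ'e (Fin.natAdd n j)
      simpa only [Fin.append_right] using this
  refine ⟨r, c, hcH, ?_⟩
  -- (5) the main argument
  rintro bb' ⟨π, hπ, hπc, hπab, hπbb⟩ p d hd
  set C₁ : Set M := range c ∪ range ab with hC₁def
  have hC₁cl : C₁ ⊆ ecl (S ∪ C₁) := subset_union_right.trans (subset_ecl _)
  have hπC₁ : ∀ x ∈ C₁, π x = x := by
    rintro x (⟨i, rfl⟩ | ⟨i, rfl⟩); exacts [hπc i, hπab i]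
  have hbb'C : ∀ j, bb' j ∈ ecl (S ∪ C₁) := by
    intro j
    rw [← hπbb, Function.comp_apply, ← Set.EqOn.image_eq_self hπC₁,
      apply_mem_ecl_union_iff hπ]
    exact hbbc j
  -- a basis `u` of `d` over `cl C₁`
  obtain ⟨J, hJd, hJ, hdJ⟩ := hP.exists_indep_basis_over (ecl (S ∪ C₁)) (range d)
  obtain ⟨k, f, hf⟩ := ((finite_range d).subset hJd).fin_embedding
  have hu : IndepFamilyOver (fun C => ecl (S ∪ C)) (ecl (S ∪ C₁)) f := indepFamilyOver_of_embedding hJ f hf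
  have huH : ∀ i, f i ∈ H := fun i => by
    obtain ⟨i', hi'⟩ := hJd (hf ▸ ⟨i, rfl⟩ : f i ∈ J); rw [← hi']; exact hd i'
  -- every `d i` lies in `cl (range c ∪ range u)` ("by the independence of `ā` from `H` over `A`")
  have hdcu : ∀ i, d i ∈ ecl (S ∪ (range c ∪ range f)) := by
    intro i
    have h1 : d i ∈ ecl (S ∪ (C₁ ∪ J)) := by
      have := hP.cl_cl_union C₁ J
      rw [← this]; exact hdJ ⟨i, rfl⟩
    have h2 : C₁ ∪ J ⊆ ecl (S ∪ ((range c ∪ J) ∪ range ((↑) : I → M))) := by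
      rw [Subtype.range_coe]
      rintro z ((hz | ⟨i', rfl⟩) | hz)
      · exact subset_ecl _ (Or.inr (Or.inl (Or.inl hz)))
      · exact ecl_mono (union_subset_union_right S (union_subset_union_left I subset_union_left)) (habc i')
      · exact subset_ecl _ (Or.inr (Or.inl (Or.inr hz)))
    have h3 : d i ∈ ecl (S ∪ ((range c ∪ J) ∪ range ((↑) : I → M))) := by
      have := ecl_mono (union_subset_union_right S h2) h1
      have hcc := hP.cl_cl ((range c ∪ J) ∪ range ((↑) : I → M))
      rw [← hcc]
      exact this
    have h4 := hP.mem_cl_of_mem_cl_union_of_indepFamilyOver hI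
      (union_subset (range_subset_iff.2 hcH) (hJd.trans (range_subset_iff.2 hd))) (hd i) h3
    rwa [hf]
  -- Claim 1, QM4 step: `π₂` fixing `c, ā, u` with `π₂ b̄' = b̄`
  set y : Fin (r + n + l) → M := Fin.append (Fin.append c ab) bb with hydef
  have hry : range y = C₁ ∪ range bb := by rw [hydef, range_append_eq_union, range_append_eq_union]
  have huy : IndepFamilyOver (fun C => ecl (S ∪ C)) (range y) f :=
    indepFamilyOver_of_subset_cl hu (by rw [hry]; exact union_subset hC₁cl (range_subset_iff.2 hbbc))
  have huy' : IndepFamilyOver (fun C => ecl (S ∪ C)) (C₁ ∪ range bb') f :=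
    indepFamilyOver_of_subset_cl hu (union_subset hC₁cl (range_subset_iff.2 hbb'C))
  have hπinv : π⁻¹ ∈ baseAut S := (baseAut S).inv_mem hπ
  have hπinvC₁ : ∀ x ∈ C₁, π⁻¹ x = x := fun x hx => inv_apply_eq_self_of_apply_eq (hπC₁ x hx)
  have hπinvbb : ⇑π⁻¹ ∘ bb' = bb := by
    funext j; rw [Function.comp_apply, Equiv.Perm.inv_eq_iff_eq, ← hπbb]; rfl
  have himg : ⇑π⁻¹ '' (C₁ ∪ range bb') = range y := by
    rw [hry, image_union, Set.EqOn.image_eq_self hπinvC₁, ← range_comp, hπinvbb]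
  have hu₁ : IndepFamilyOver (fun C => ecl (S ∪ C)) (range y) (⇑π⁻¹ ∘ f) := by
    rw [← himg]; exact indepFamilyOver_comp_of_mem_baseAut hπinv huy'
  obtain ⟨τ, hτ, hτy, hτu⟩ :=
    exists_mem_baseAut_comp_eq_of_indepFamilyOver hsurj hSEAC hinf hS y (⇑π⁻¹ ∘ f) f hu₁ huy
  have hτC₁ : ∀ x ∈ C₁, τ x = x := by
    rintro x (⟨i, rfl⟩ | ⟨i, rfl⟩)
    · have := hτy (Fin.castAdd l (Fin.castAdd n i)); simpa only [hydef, Fin.append_left] using this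
    · have := hτy (Fin.castAdd l (Fin.natAdd r i)); simpa only [hydef, Fin.append_left, Fin.append_right] using this
  have hτbb : ∀ j, τ (bb j) = bb j := fun j => by
    have := hτy (Fin.natAdd (r + n) j); simpa only [hydef, Fin.append_right] using this
  set π₂ : Equiv.Perm M := τ * π⁻¹ with hπ₂def
  have hπ₂ : π₂ ∈ baseAut S := (baseAut S).mul_mem hτ hπinv
  have hπ₂C₁ : ∀ x ∈ C₁, π₂ x = x := fun x hx => by
    rw [hπ₂def, Equiv.Perm.mul_apply, hπinvC₁ x hx, hτC₁ x hx]
  have hπ₂c : ∀ i, π₂ (c i) = c i := fun i => hπ₂C₁ _ (Or.inl ⟨i, rfl⟩)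
  have hπ₂ab : ∀ i, π₂ (ab i) = ab i := fun i => hπ₂C₁ _ (Or.inr ⟨i, rfl⟩)
  have hπ₂u : ∀ i, π₂ (f i) = f i := fun i => by
    rw [hπ₂def, Equiv.Perm.mul_apply]; exact congrFun hτu i
  have hπ₂bb : ∀ j, π₂ (bb' j) = bb j := fun j => by
    rw [hπ₂def, Equiv.Perm.mul_apply]
    have : π⁻¹ (bb' j) = bb j := congrFun hπinvbb j
    rw [this, hτbb j]
  -- `d' = π₂ d` lies in `H`
  have hcu : ⇑π₂ ∘ Fin.append c f = Fin.append c f := by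
    funext i
    refine Fin.addCases (fun j => ?_) (fun j => ?_) i
    · simp only [Function.comp_apply, Fin.append_left]; exact hπ₂c j
    · simp only [Function.comp_apply, Fin.append_right]; exact hπ₂u j
  have hd' : ∀ i, π₂ (d i) ∈ H := by
    intro i
    have h1 : π₂ (d i) ∈ ecl (S ∪ range (Fin.append c f)) := by
      rw [apply_mem_ecl_union_range_iff hπ₂ hcu, range_append_eq_union]; exact hdcu i
    refine hclH ?_ h1
    rw [range_append_eq_union]
    exact union_subset (range_subset_iff.2 hcH) (range_subset_iff.2 huH)
  -- non-splitting over `c`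
  obtain ⟨θ', hθ', hθ'c, hθ'd, hθ'ab, hθ'bb⟩ := hNS' d (⇑π₂ ∘ d) hd hd' π₂ hπ₂ hπ₂c rfl
  -- the answer `π' = π₂⁻¹ θ'`
  refine ⟨π₂⁻¹ * θ', (baseAut S).mul_mem ((baseAut S).inv_mem hπ₂) hθ', fun i => ?_, fun i => ?_,
    fun i => ?_, ?_⟩
  · rw [Equiv.Perm.mul_apply, Equiv.Perm.inv_eq_iff_eq]; exact congrFun hθ'd i
  · rw [Equiv.Perm.mul_apply, hθ'c i]; exact inv_apply_eq_self_of_apply_eq (hπ₂c i)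
  · rw [Equiv.Perm.mul_apply, hθ'ab i]; exact inv_apply_eq_self_of_apply_eq (hπ₂ab i)
  · funext j
    rw [Function.comp_apply, Equiv.Perm.mul_apply, hθ'bb j, Equiv.Perm.inv_eq_iff_eq]
    exact (hπ₂bb j).symm

/-! ### BHHKK Cor. 5.3: homogeneity over closed countable sets -/

/-- **`ℵ₀`-homogeneity over closed countable sets** (Bays–Hart–Hyttinen–Kesälä–Kirby 2014,
Cor. 5.3, (c) ⟹ (a); Bays–Kirby 2018, Def. 6.1 QM5 / Prop. 6.5, for Galois types): let `H` be
closed for `C ↦ ecl (S ∪ C)`, `f : M → M`, and `b, b'` finite tuples such that for every finite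
tuple `s` from `H` some automorphism over `ecl S` agrees with `f` on `s` and maps `b ↦ b'`. Then
for every `a ∈ ecl (S ∪ H ∪ b)` there is `a'` such that the same holds with moreover `a ↦ a'`.
Proof (loc. cit.): isolate `tp(a/H b)` over a finite `c ⊆ H` (`exists_isolation`), put
`a' = ρ₀ a` for one `ρ₀` matching `c b`, and for a general `s` correct a matching `ρ₁` of `c s b`
by the isolation. [cite: BHHKK2014, Cor. 5.3] [cite: BaysKirby2018ANT, Def. 6.1 (QM5) and Thm 6.9] -/
theorem homogeneity_over_closed (hsurj : IsSurjectiveOntoUnits M) (hSEAC : IsStronglyExpAlgClosed M)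
    (hinf : ∀ C : Set M, C.Finite → ∃ d, d ∉ ecl C)
    {S : Set M} (hS : S.Finite) {H : Set M} (hH : ecl (S ∪ H) = H) (f : M → M)
    {n : ℕ} {b b' : Fin n → M}
    (hloc : ∀ ⦃m : ℕ⦄ (s : Fin m → M), (∀ i, s i ∈ H) →
      ∃ ρ ∈ baseAut S, ⇑ρ ∘ s = f ∘ s ∧ ⇑ρ ∘ b = b')
    {a : M} (ha : a ∈ ecl (S ∪ (H ∪ range b))) :
    ∃ a' : M, ∀ ⦃m : ℕ⦄ (s : Fin m → M), (∀ i, s i ∈ H) →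
      ∃ ρ ∈ baseAut S, ⇑ρ ∘ s = f ∘ s ∧ ⇑ρ ∘ b = b' ∧ ρ a = a' := by
  classical
  obtain ⟨r, c, hcH, hiso⟩ := exists_isolation hsurj hSEAC hinf hS hH b (bb := ![a])
    (fun j => by fin_cases j; simpa using ha)
  obtain ⟨ρ₀, hρ₀, hρ₀c, hρ₀b⟩ := hloc c hcH
  refine ⟨ρ₀ a, fun m s hs => ?_⟩
  obtain ⟨ρ₁, hρ₁, hρ₁cs, hρ₁b⟩ := hloc (Fin.append c s)
    (fun i => Fin.addCases (fun j => by simpa using hcH j) (fun j => by simpa using hs j) i)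
  have hρ₁c : ∀ i, ρ₁ (c i) = f (c i) := fun i => by
    have := congrFun hρ₁cs (Fin.castAdd m i)
    simpa only [Function.comp_apply, Fin.append_left] using this
  have hρ₁s : ⇑ρ₁ ∘ s = f ∘ s := by
    funext i
    have := congrFun hρ₁cs (Fin.natAdd r i)
    simpa only [Function.comp_apply, Fin.append_right] using this
  -- `π = ρ₁⁻¹ ρ₀` fixes `c` and `b`
  set π : Equiv.Perm M := ρ₁⁻¹ * ρ₀ with hπdef
  have hπ : π ∈ baseAut S := (baseAut S).mul_mem ((baseAut S).inv_mem hρ₁) hρ₀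
  have hπc : ∀ i, π (c i) = c i := fun i => by
    rw [hπdef, Equiv.Perm.mul_apply, Equiv.Perm.inv_eq_iff_eq, hρ₁c i]
    exact (congrFun hρ₀c i)
  have hπb : ∀ i, π (b i) = b i := fun i => by
    rw [hπdef, Equiv.Perm.mul_apply, Equiv.Perm.inv_eq_iff_eq]
    rw [show ρ₀ (b i) = b' i from congrFun hρ₀b i, show ρ₁ (b i) = b' i from congrFun hρ₁b i]
  obtain ⟨π', hπ', hπ's, -, hπ'b, hπ'a⟩ := hiso ![π a]
    ⟨π, hπ, hπc, hπb, by funext j; fin_cases j; rfl⟩ s hs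
  refine ⟨ρ₁ * π', (baseAut S).mul_mem hρ₁ hπ', ?_, ?_, ?_⟩
  · funext i; rw [Function.comp_apply, Equiv.Perm.mul_apply, hπ's i]; exact congrFun hρ₁s i
  · funext i; rw [Function.comp_apply, Equiv.Perm.mul_apply, hπ'b i]; exact congrFun hρ₁b i
  · rw [Equiv.Perm.mul_apply]
    have : π' a = π a := by
      have := congrFun hπ'a 0
      simpa using this
    rw [this, hπdef, Equiv.Perm.mul_apply]
    exact (Equiv.Perm.eq_inv_iff_eq).1 rfl

end Countable

end SEACModel

end Literature.NumberTheory.Transcendental
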